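import Literature.Barriers.BirchSwinnertonDyer.RankNotSumOfLocalInvariantsK1Tables
import Mathlib.Tactic.ReduceModChar
import HarnessLib

/-!
# `rk E(F₄)` for `E = 480a1` via `ℚ(√-1)`, V: the local conditions at the odd bad primes

The local computations of the complete `2`-descents over `K1 = ℚ(√-1)` for the twists
`E^{(d)} : y² = x(x + 2d)(x - 3d)` (`e₁ = 0, e₂ = -2d, e₃ = 3d`) at the odd primes of bad
reduction (Silverman AEC X.1, proof of Prop. X.1.4 / Example X.1.5: the image of
`E(K_v)/2E(K_v)` in `K_v^×/K_v^{×2} × K_v^×/K_v^{×2}` at a finite place `v ∤ 2`, here read on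
`K1`-rational points through the characters of files II–IV). A point `(x, y)`, `y ≠ 0`, is
encoded integrally: `x = z/n`, `y = w/m` with `z, n, w, m ∈ ℤ[i]` and
`w² n³ = m² · z (z + 2dn)(z - 3dn)` (`b₁ = x = z/n`, `b₂ = x + 2d = (z + 2dn)/n`), and for a
square-class character `χ` one has `χ(b₁) = χ(z) + χ(n)`, `χ(b₂) = χ(z + 2dn) + χ(n)`.

* `local_mult_five` — **multiplicative primes** `p ∣ 5`, `p ∤ d` (`e₂ ≡ e₃`): `ord_p(b₁)` is
  even and `qr_p(b₁) = ord_p(b₂) · (1 + qr_p(d))`; i.e. `qr_p(b₁) = ord_p(b₂)` when `d` is a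
  square mod `p` (`d = 1, 41`), `qr_p(b₁) = 0` when it is not (`d = 73, 2993`)
  (`five_a_conditions`, `five_b_conditions`).
* `local_additive` — **additive primes** `p ∥ d` (`d = 41, 73, 2993`; all `eᵢ ≡ 0`): the class
  `(ord_p b₁, qr_p b₁, ord_p b₂, qr_p b₂)` is one of four explicit vectors of Legendre symbols;
  evaluated: at `5 ± 4i` (`41 ∣ d`) `qr(b₁) = ord(b₂)` and `qr(b₂) = 0`
  (`fortyone_a_conditions`, `fortyone_b_conditions`); at `8 ± 3i` (`73 ∣ d`) `qr(b₁) = 0` and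
  `qr(b₂) = ord(b₁)` (`seventythree_a_conditions`, `seventythree_b_conditions`).

The proofs are the case analysis on `ord_p(x)` versus `0` (leading `p`-adic digits, i.e. unit
parts read through the reduction map `ℤ[i] → 𝔽_q` of file III). Everything is proved.

## References

* J. H. Silverman, *The Arithmetic of Elliptic Curves*, 2nd ed., GTM 106 (2009), Ch. X §1,
  Prop. X.1.4, Example X.1.5 (local images at odd primes). [SilvermanAEC2009]
* T. Dokchitser, V. Dokchitser, *A note on the Mordell–Weil rank modulo `n`*, J. Number Theory
  131 (2011) 1833–1839, arXiv:0910.4588, proof of Thm. 2. [DokchitserDokchitser2011RankModN]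
-/

namespace Literature.Barriers.BirchSwinnertonDyer.DokchitserDokchitser2011

open QuadraticAlgebra

/-- Mathlib's Gaussian integers `ℤ√-1` (the notation `ℤ[i]` is local to Mathlib's file). -/
local notation "ℤ[i]" => GaussianInt

/-! ### The integral curve equation and characters -/

section Equation

variable {d : ℤ} {z n w m : ℤ[i]}

/-- On `w² n³ = m² z (z + 2dn)(z - 3dn)` with `w, n, m ≠ 0`, the three factors are non-zero.
[folklore] -/
theorem factors_ne_zero_of_eq (hn : n ≠ 0) (hw : w ≠ 0)
    (heq : w ^ 2 * n ^ 3 = m ^ 2 * (z * (z + 2 * d * n) * (z - 3 * d * n))) :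
    z ≠ 0 ∧ z + 2 * d * n ≠ 0 ∧ z - 3 * d * n ≠ 0 := by
  have h : m ^ 2 * (z * (z + 2 * d * n) * (z - 3 * d * n)) ≠ 0 := by
    rw [← heq]; exact mul_ne_zero (pow_ne_zero 2 hw) (pow_ne_zero 3 hn)
  simp only [ne_eq, mul_eq_zero, not_or] at h
  exact ⟨h.2.1.1, h.2.1.2, h.2.2⟩

/-- **A square-class character on the curve equation**: `χ(n) = χ(z) + χ(z + 2dn) + χ(z - 3dn)`
(from `w² n³ = m² z (z+2dn)(z-3dn)`, squares dying and `3 = 1` in `ℤ/2`). [folklore] -/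
theorem MulBit.apply_curve_eq (χ : MulBit) (hn : n ≠ 0) (hm : m ≠ 0) (hw : w ≠ 0)
    (heq : w ^ 2 * n ^ 3 = m ^ 2 * (z * (z + 2 * d * n) * (z - 3 * d * n))) :
    χ n = χ z + χ (z + 2 * d * n) + χ (z - 3 * d * n) := by
  obtain ⟨hz, h2, h3⟩ := factors_ne_zero_of_eq hn hw heq
  have h := congrArg χ heq
  rw [χ.map_mul (pow_ne_zero 2 hw) (pow_ne_zero 3 hn), χ.map_sq hw, χ.map_pow hn,
    χ.map_mul (pow_ne_zero 2 hm) (mul_ne_zero (mul_ne_zero hz h2) h3), χ.map_sq hm,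
    χ.map_mul (mul_ne_zero hz h2) h3, χ.map_mul hz h2] at h
  have h3' : ((3 : ℕ) : ZMod 2) = 1 := by decide
  rw [h3', one_mul, zero_add, zero_add] at h
  exact h

end Equation

/-! ### Constants: quadratic residues modulo `5`, `41`, `73` -/

/-- `2` and `3 = -2` are non-residues, `-1 = 4` a residue mod `5`. [folklore] -/
theorem qrBitZMod_five : qrBitZMod 5 2 = 1 ∧ qrBitZMod 5 3 = 1 ∧ qrBitZMod 5 (-3) = 1 ∧
    qrBitZMod 5 4 = 0 ∧ qrBitZMod 5 1 = 0 := by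
  refine ⟨(qrBitZMod_eq_one_iff _).mpr (not_isSquare_of_forall_ne _ (by decide)),
    (qrBitZMod_eq_one_iff _).mpr (not_isSquare_of_forall_ne _ (by decide)),
    (qrBitZMod_eq_one_iff _).mpr (not_isSquare_of_forall_ne _ (by decide)),
    (qrBitZMod_eq_zero_iff _).mpr ⟨2, by decide⟩, (qrBitZMod_eq_zero_iff _).mpr ⟨1, by decide⟩⟩

/-! ### Multiplicative primes: `p ∣ 5`, `p ∤ d` -/

section Mult

variable {p p' : ℤ[i]} (hp : Prime p) (h5 : (5 : ℤ[i]) = p * p') (hp' : ¬ p ∣ p')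
  (hp2 : ¬ p ∣ 2) (hp3 : ¬ p ∣ 3) (φ : ℤ[i] →+* ZMod 5) (hker : ∀ z, φ z = 0 ↔ p ∣ z)
  (hψ : ∀ c d : ℤ[i], ¬ p ∣ c → ¬ p ∣ d →
    qrBitZMod 5 (φ (c * d)) = qrBitZMod 5 (φ c) + qrBitZMod 5 (φ d))

include h5 hp' hp2 hp3 hker

/-- **The local conditions at a multiplicative prime `p ∣ 5`, `p ∤ d`** (`e₂ ≡ e₃ (mod p)`):
for a point encoded as `w² n³ = m² z (z + 2dn)(z - 3dn)`, `ord_p(b₁) = ord_p(z) + ord_p(n)` is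
even, and `qr_p(b₁) = ord_p(b₂) · (1 + qr_p(d))`. Cases: `ord_p z < ord_p n` (all three factors
have the leading digit of `z`); `ord_p z > ord_p n` (`z + 2dn`, `z - 3dn` have leading digits
`2d ν`, `-3d ν`, and `2 · (-3) = 4` is a square mod `5`); `ord_p z = ord_p n` and
`x ≢ 3d`: the last two factors have equal leading digit; `x ≡ 3d ≡ -2d`: `qr_p(b₁) = qr(3d)`
and exactly one of `ord_p(z + 2dn) - ord_p(n)`, `ord_p(z - 3dn) - ord_p(n)` is `1`, both being
odd. [cite: SilvermanAEC2009, Ch. X §1 (Prop. X.1.4, local image at v ∤ 2)] -/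
theorem local_mult_five {d : ℤ} (hd : ¬ p ∣ d) {z n w m : ℤ[i]} (hn : n ≠ 0) (hm : m ≠ 0)
    (hw : w ≠ 0) (heq : w ^ 2 * n ^ 3 = m ^ 2 * (z * (z + 2 * d * n) * (z - 3 * d * n))) :
    MulBit.ofPrime p hp z + MulBit.ofPrime p hp n = 0 ∧
    MulBit.ofDigit p hp φ (qrBitZMod 5) hψ z + MulBit.ofDigit p hp φ (qrBitZMod 5) hψ n =
      (MulBit.ofPrime p hp (z + 2 * d * n) + MulBit.ofPrime p hp n) *
        (1 + qrBitZMod 5 (φ d)) := by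
  obtain ⟨hz, hZ2, hZ3⟩ := factors_ne_zero_of_eq hn hw heq
  set χv := MulBit.ofPrime p hp with hχv
  set χq := MulBit.ofDigit p hp φ (qrBitZMod 5) hψ with hχq
  have Ev := χv.apply_curve_eq hn hm hw heq
  have Eq := χq.apply_curve_eq hn hm hw heq
  obtain ⟨u, hzu, hu⟩ := exists_eq_pow_multiplicity_mul hp hz
  obtain ⟨ν, hnν, hν⟩ := exists_eq_pow_multiplicity_mul hp hn
  set k := multiplicity p z with hk
  set a := multiplicity p n with ha
  have hφu : φ u ≠ 0 := fun h => hu ((hker u).mp h)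
  have hφν : φ ν ≠ 0 := fun h => hν ((hker ν).mp h)
  have hφd : φ d ≠ 0 := fun h => hd ((hker d).mp h)
  have hφ2 : φ 2 ≠ 0 := fun h => hp2 ((hker 2).mp h)
  have hφ3 : φ 3 ≠ 0 := fun h => hp3 ((hker 3).mp h)
  have hφp : φ p = 0 := (hker p).mpr dvd_rfl
  obtain ⟨C2, C3, Cm3, C4, C1⟩ := qrBitZMod_five
  have hφ2' : φ 2 = 2 := map_ofNat φ 2
  have hφ3' : φ 3 = 3 := map_ofNat φ 3
  -- values of the characters on `p^k c`
  have vpow : ∀ (c : ℤ[i]) (j : ℕ), ¬ p ∣ c → χv (p ^ j * c) = j := fun c j hc =>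
    MulBit.ofPrime_pow_mul hp hc j
  have qpow : ∀ (c : ℤ[i]) (j : ℕ), ¬ p ∣ c → χq (p ^ j * c) = qrBitZMod 5 (φ c) := fun c j hc =>
    MulBit.ofDigit_pow_mul hp φ _ hψ hc j
  have two : ∀ t : ZMod 2, t + t = 0 := CharTwo.add_self_eq_zero
  rcases lt_trichotomy k a with hlt | heqk | hgt
  · -- `k < a`
    obtain ⟨r, hr⟩ := Nat.exists_eq_add_of_lt hlt
    have hZ2e : z + 2 * d * n = p ^ k * (u + 2 * d * p ^ (r + 1) * ν) := by
      rw [hzu, hnν, hr]; ring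
    have hZ3e : z - 3 * d * n = p ^ k * (u - 3 * d * p ^ (r + 1) * ν) := by
      rw [hzu, hnν, hr]; ring
    have hU2φ : φ (u + 2 * d * p ^ (r + 1) * ν) = φ u := by
      simp [map_add, map_mul, map_pow, hφp]
    have hU3φ : φ (u - 3 * d * p ^ (r + 1) * ν) = φ u := by
      simp [map_sub, map_mul, map_pow, hφp]
    have hU2 : ¬ p ∣ (u + 2 * d * p ^ (r + 1) * ν) := fun h => hφu (hU2φ ▸ (hker _).mpr h)
    have hU3 : ¬ p ∣ (u - 3 * d * p ^ (r + 1) * ν) := fun h => hφu (hU3φ ▸ (hker _).mpr h)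
    rw [hZ2e, hZ3e, hzu, hnν, vpow u k hu, vpow _ k hU2, vpow _ k hU3, vpow ν a hν] at Ev
    rw [hZ2e, hZ3e, hzu, hnν, qpow u k hu, qpow _ k hU2, qpow _ k hU3, qpow ν a hν, hU2φ, hU3φ,
      two, zero_add] at Eq
    have hak : ((a : ℕ) : ZMod 2) = k := by
      linear_combination (norm := (ring_nf; reduce_mod_char)) Ev
    rw [hZ2e, hzu, hnν, vpow u k hu, vpow ν a hν, vpow _ k hU2, qpow u k hu, qpow ν a hν, Eq,
      hak, two, two, zero_mul]
    exact ⟨rfl, rfl⟩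
  · -- `k = a`
    have hZ2e : z + 2 * d * n = p ^ k * (u + 2 * d * ν) := by rw [hzu, hnν, ← heqk]; ring
    have hZ3e : z - 3 * d * n = p ^ k * (u - 3 * d * ν) := by rw [hzu, hnν, ← heqk]; ring
    have hU2ne : u + 2 * d * ν ≠ 0 := by
      intro h; rw [h, mul_zero] at hZ2e; exact hZ2 hZ2e
    have hU3ne : u - 3 * d * ν ≠ 0 := by
      intro h; rw [h, mul_zero] at hZ3e; exact hZ3 hZ3e
    have hφU3 : φ (u - 3 * d * ν) = φ (u + 2 * d * ν) := by
      simp only [map_sub, map_add, map_mul, hφ2', hφ3']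
      have : (3 : ZMod 5) = -2 := by decide
      rw [this]; ring
    by_cases hs : φ (u + 2 * d * ν) = 0
    · -- `x ≡ -2d ≡ 3d`: both `u + 2dν` and `u - 3dν` are divisible by `p`
      have hpU2 : p ∣ u + 2 * d * ν := (hker _).mp hs
      have hpU3 : p ∣ u - 3 * d * ν := (hker _).mp (hφU3.trans hs)
      obtain ⟨U2, hU2e, hU2⟩ := exists_eq_pow_multiplicity_mul hp hU2ne
      obtain ⟨U3, hU3e, hU3⟩ := exists_eq_pow_multiplicity_mul hp hU3ne
      set k2 := multiplicity p (u + 2 * d * ν) with hk2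
      set k3 := multiplicity p (u - 3 * d * ν) with hk3
      have hk2pos : 0 < k2 :=
        (finiteMultiplicity_of_prime hp hU2ne).lt_multiplicity_of_lt_emultiplicity (by
          rw [Nat.cast_zero]; exact emultiplicity_pos_of_dvd hpU2)
      have hk3pos : 0 < k3 :=
        (finiteMultiplicity_of_prime hp hU3ne).lt_multiplicity_of_lt_emultiplicity (by
          rw [Nat.cast_zero]; exact emultiplicity_pos_of_dvd hpU3)
      have hZ2f : z + 2 * d * n = p ^ (k + k2) * U2 := by rw [hZ2e, hU2e]; ring
      have hZ3f : z - 3 * d * n = p ^ (k + k3) * U3 := by rw [hZ3e, hU3e]; ring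
      -- parity: `k2 + k3` even
      rw [hZ2f, hZ3f, hzu, hnν, vpow u k hu, vpow _ _ hU2, vpow _ _ hU3, vpow ν a hν, ← heqk]
        at Ev
      -- `k2` is odd: otherwise `p² ∣ 5 d ν`
      have hk2odd : ¬ 2 ∣ k2 := by
        intro h2
        have hev : (2 : ℕ) ∣ k3 := by
          have hE : ((k2 + k3 : ℕ) : ZMod 2) = 0 := by
            push_cast at Ev ⊢
            linear_combination (norm := (ring_nf; reduce_mod_char)) Ev
          rw [ZMod.natCast_eq_zero_iff_even] at hE
          have := (Nat.even_add.mp hE).mp (even_iff_two_dvd.mpr h2)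
          exact even_iff_two_dvd.mp this
        have h2le : 2 ≤ k2 := by obtain ⟨t, ht⟩ := h2; omega
        have h3le : 2 ≤ k3 := by obtain ⟨t, ht⟩ := hev; omega
        have hd2 : p ^ 2 ∣ u + 2 * d * ν := (pow_dvd_pow p h2le).trans ⟨U2, hU2e⟩
        have hd3 : p ^ 2 ∣ u - 3 * d * ν := (pow_dvd_pow p h3le).trans ⟨U3, hU3e⟩
        have hdiff : p ^ 2 ∣ 5 * d * ν := by
          have : (5 : ℤ[i]) * d * ν = (u + 2 * d * ν) - (u - 3 * d * ν) := by ring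
          rw [this]; exact dvd_sub hd2 hd3
        rw [h5, pow_two, mul_assoc, mul_assoc] at hdiff
        have h1 : p ∣ p' * (d * ν) := (mul_dvd_mul_iff_left hp.ne_zero).mp hdiff
        rcases hp.dvd_or_dvd h1 with h | h
        · exact hp' h
        · rcases hp.dvd_or_dvd h with h | h
          · exact hd h
          · exact hν h
      have hk2one : ((k2 : ℕ) : ZMod 2) = 1 := by
        rw [ZMod.natCast_eq_one_iff_odd, Nat.odd_iff]; omega
      have hφu' : φ u = 3 * φ d * φ ν := by
        have : φ u + 2 * φ d * φ ν = 0 := by simpa [map_add, map_mul, hφ2'] using hs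
        have h5' : (3 : ZMod 5) = -2 := by decide
        rw [h5']; linear_combination this
      have hqu : qrBitZMod 5 (φ u) = 1 + qrBitZMod 5 (φ d) + qrBitZMod 5 (φ ν) := by
        rw [hφu', qrBitZMod_mul (mul_ne_zero (by decide) hφd) hφν,
          qrBitZMod_mul (by decide) hφd, C3]
      refine ⟨?_, ?_⟩
      · rw [hzu, hnν, vpow u k hu, vpow ν a hν, ← heqk, two]
      · rw [hZ2f, hzu, hnν, qpow u k hu, qpow ν a hν, vpow _ _ hU2, vpow ν a hν, ← heqk, hqu]
        push_cast
        rw [hk2one]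
        linear_combination (norm := (ring_nf; reduce_mod_char))
    · -- `x ≢ -2d`: `u + 2dν` and `u - 3dν` are units with the same digit
      have hU2 : ¬ p ∣ u + 2 * d * ν := fun h => hs ((hker _).mpr h)
      have hU3 : ¬ p ∣ u - 3 * d * ν := fun h => hs (hφU3 ▸ (hker _).mpr h)
      rw [hZ2e, hZ3e, hzu, hnν, qpow u k hu, qpow _ k hU2, qpow _ k hU3, qpow ν a hν, hφU3,
        add_assoc, two, add_zero] at Eq
      refine ⟨?_, ?_⟩
      · rw [hzu, hnν, vpow u k hu, vpow ν a hν, ← heqk, two]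
      · rw [hZ2e, hzu, hnν, qpow u k hu, qpow ν a hν, vpow _ k hU2, vpow ν a hν, ← heqk, ← Eq,
          two, two, zero_mul]
  · -- `k > a`
    obtain ⟨r, hr⟩ := Nat.exists_eq_add_of_lt hgt
    have hZ2e : z + 2 * d * n = p ^ a * (p ^ (r + 1) * u + 2 * d * ν) := by
      rw [hzu, hnν, hr]; ring
    have hZ3e : z - 3 * d * n = p ^ a * (p ^ (r + 1) * u - 3 * d * ν) := by
      rw [hzu, hnν, hr]; ring
    have hU2φ : φ (p ^ (r + 1) * u + 2 * d * ν) = 2 * φ d * φ ν := by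
      simp [map_add, map_mul, map_pow, hφp, hφ2']
    have hU3φ : φ (p ^ (r + 1) * u - 3 * d * ν) = -3 * φ d * φ ν := by
      simp [map_sub, map_mul, map_pow, hφp, hφ3']
    have h2ne : (2 : ZMod 5) * φ d * φ ν ≠ 0 := mul_ne_zero (mul_ne_zero (by decide) hφd) hφν
    have h3ne : (-3 : ZMod 5) * φ d * φ ν ≠ 0 := mul_ne_zero (mul_ne_zero (by decide) hφd) hφν
    have hU2 : ¬ p ∣ (p ^ (r + 1) * u + 2 * d * ν) := fun h =>
      h2ne (hU2φ ▸ (hker _).mpr h)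
    have hU3 : ¬ p ∣ (p ^ (r + 1) * u - 3 * d * ν) := fun h =>
      h3ne (hU3φ ▸ (hker _).mpr h)
    rw [hZ2e, hZ3e, hzu, hnν, vpow u k hu, vpow _ a hU2, vpow _ a hU3, vpow ν a hν] at Ev
    rw [hZ2e, hZ3e, hzu, hnν, qpow u k hu, qpow _ a hU2, qpow _ a hU3, qpow ν a hν, hU2φ, hU3φ,
      qrBitZMod_mul (mul_ne_zero (by decide) hφd) hφν, qrBitZMod_mul (by decide) hφd,
      qrBitZMod_mul (mul_ne_zero (by decide) hφd) hφν, qrBitZMod_mul (by decide) hφd, C2, Cm3]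
      at Eq
    refine ⟨?_, ?_⟩
    · rw [hzu, hnν, vpow u k hu, vpow ν a hν]
      linear_combination (norm := (ring_nf; reduce_mod_char)) Ev
    · rw [hZ2e, hzu, hnν, qpow u k hu, qpow ν a hν, vpow _ a hU2, vpow ν a hν, two, zero_mul]
      linear_combination (norm := (ring_nf; reduce_mod_char)) Eq

end Mult

/-! ### Additive primes: `p ∥ d` -/

section Additive

variable {q : ℕ} [Fact q.Prime] {p δ : ℤ[i]} (hp : Prime p) (hpδ : ¬ p ∣ δ)
  (hp2 : ¬ p ∣ 2) (hp3 : ¬ p ∣ 3) (hp5 : ¬ p ∣ 5) (φ : ℤ[i] →+* ZMod q)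
  (hker : ∀ z, φ z = 0 ↔ p ∣ z)
  (hψ : ∀ c d : ℤ[i], ¬ p ∣ c → ¬ p ∣ d →
    qrBitZMod q (φ (c * d)) = qrBitZMod q (φ c) + qrBitZMod q (φ d))

include hpδ hp2 hp3 hp5 hker

/-- **The local conditions at an additive prime `p ∥ d`** (`d = p δ`, `p ∤ 2·3·5·δ`; all three
roots `0, -2d, 3d` are `≡ 0`): for a point encoded as `w² n³ = m² z (z + 2dn)(z - 3dn)`, the
vector `(ord_p b₁, qr_p b₁, ord_p b₂, qr_p b₂) (mod 2)` is one of
`(0,0,0,0)`, `(0, qr(2)+qr(-3), 1, qr(2)+qr(δ))`, `(1, qr(-2)+qr(δ), 0, qr(-2)+qr(-5))`,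
`(1, qr(3)+qr(δ), 1, qr(5)+qr(δ))` (Legendre symbols mod `q = N(p)`), according as
`ord_p z ≤ ord_p n`, `ord_p z ≥ ord_p n + 2`, or `ord_p z = ord_p n + 1` with `x/p ≡ -2δ`
resp. `≡ 3δ` (`x/p ≢ -2δ, 3δ` is impossible: the valuation of `y²` would be odd).
[cite: SilvermanAEC2009, Ch. X §1 (Prop. X.1.4, local image at v ∤ 2)] -/
theorem local_additive {d : ℤ} (hd : (d : ℤ[i]) = p * δ) {z n w m : ℤ[i]} (hn : n ≠ 0)
    (hm : m ≠ 0) (hw : w ≠ 0)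
    (heq : w ^ 2 * n ^ 3 = m ^ 2 * (z * (z + 2 * d * n) * (z - 3 * d * n))) :
    let v1 := MulBit.ofPrime p hp z + MulBit.ofPrime p hp n
    let q1 := MulBit.ofDigit p hp φ (qrBitZMod q) hψ z + MulBit.ofDigit p hp φ (qrBitZMod q) hψ n
    let v2 := MulBit.ofPrime p hp (z + 2 * d * n) + MulBit.ofPrime p hp n
    let q2 := MulBit.ofDigit p hp φ (qrBitZMod q) hψ (z + 2 * d * n) +
      MulBit.ofDigit p hp φ (qrBitZMod q) hψ n
    (v1 = 0 ∧ q1 = 0 ∧ v2 = 0 ∧ q2 = 0) ∨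
    (v1 = 0 ∧ q1 = qrBitZMod q 2 + qrBitZMod q (-3) ∧ v2 = 1 ∧
      q2 = qrBitZMod q 2 + qrBitZMod q (φ δ)) ∨
    (v1 = 1 ∧ q1 = qrBitZMod q (-2) + qrBitZMod q (φ δ) ∧ v2 = 0 ∧
      q2 = qrBitZMod q (-2) + qrBitZMod q (-5)) ∨
    (v1 = 1 ∧ q1 = qrBitZMod q 3 + qrBitZMod q (φ δ) ∧ v2 = 1 ∧
      q2 = qrBitZMod q 5 + qrBitZMod q (φ δ)) := by
  intro v1 q1 v2 q2
  obtain ⟨hz, hZ2, hZ3⟩ := factors_ne_zero_of_eq hn hw heq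
  set χv := MulBit.ofPrime p hp with hχv
  set χq := MulBit.ofDigit p hp φ (qrBitZMod q) hψ with hχq
  have Ev := χv.apply_curve_eq hn hm hw heq
  have Eq := χq.apply_curve_eq hn hm hw heq
  obtain ⟨u, hzu, hu⟩ := exists_eq_pow_multiplicity_mul hp hz
  obtain ⟨ν, hnν, hν⟩ := exists_eq_pow_multiplicity_mul hp hn
  set k := multiplicity p z with hk
  set a := multiplicity p n with ha
  have hφu : φ u ≠ 0 := fun h => hu ((hker u).mp h)
  have hφν : φ ν ≠ 0 := fun h => hν ((hker ν).mp h)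
  have hφδ : φ δ ≠ 0 := fun h => hpδ ((hker δ).mp h)
  have hφ2 : (2 : ZMod q) ≠ 0 := fun h => hp2 ((hker 2).mp (by rw [map_ofNat, h]))
  have hφ3 : (3 : ZMod q) ≠ 0 := fun h => hp3 ((hker 3).mp (by rw [map_ofNat, h]))
  have hφ5 : (5 : ZMod q) ≠ 0 := fun h => hp5 ((hker 5).mp (by rw [map_ofNat, h]))
  have hφm2 : (-2 : ZMod q) ≠ 0 := neg_ne_zero.mpr hφ2
  have hφm3 : (-3 : ZMod q) ≠ 0 := neg_ne_zero.mpr hφ3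
  have hφm5 : (-5 : ZMod q) ≠ 0 := neg_ne_zero.mpr hφ5
  have hφp : φ p = 0 := (hker p).mpr dvd_rfl
  have vpow : ∀ (c : ℤ[i]) (j : ℕ), ¬ p ∣ c → χv (p ^ j * c) = j := fun c j hc =>
    MulBit.ofPrime_pow_mul hp hc j
  have qpow : ∀ (c : ℤ[i]) (j : ℕ), ¬ p ∣ c → χq (p ^ j * c) = qrBitZMod q (φ c) := fun c j hc =>
    MulBit.ofDigit_pow_mul hp φ _ hψ hc j
  have two : ∀ t : ZMod 2, t + t = 0 := CharTwo.add_self_eq_zero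
  -- `2dn = 2δ p^(a+1) ν`, `3dn = 3δ p^(a+1) ν`
  rcases Nat.lt_or_ge a k with hak | hka
  · -- `k ≥ a + 1`
    rcases Nat.lt_or_ge (a + 1) k with hak2 | hka2
    · -- `k ≥ a + 2`
      obtain ⟨r, hr⟩ := Nat.exists_eq_add_of_lt hak2
      have hZ2e : z + 2 * d * n = p ^ (a + 1) * (p ^ (r + 1) * u + 2 * δ * ν) := by
        rw [hzu, hnν, hr, hd]; ring
      have hZ3e : z - 3 * d * n = p ^ (a + 1) * (p ^ (r + 1) * u - 3 * δ * ν) := by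
        rw [hzu, hnν, hr, hd]; ring
      have hU2φ : φ (p ^ (r + 1) * u + 2 * δ * ν) = 2 * φ δ * φ ν := by
        simp [map_add, map_mul, map_pow, hφp, map_ofNat]
      have hU3φ : φ (p ^ (r + 1) * u - 3 * δ * ν) = -3 * φ δ * φ ν := by
        simp [map_sub, map_mul, map_pow, hφp, map_ofNat]
      have h2ne : (2 : ZMod q) * φ δ * φ ν ≠ 0 := mul_ne_zero (mul_ne_zero hφ2 hφδ) hφν
      have h3ne : (-3 : ZMod q) * φ δ * φ ν ≠ 0 := mul_ne_zero (mul_ne_zero hφm3 hφδ) hφν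
      have hU2 : ¬ p ∣ (p ^ (r + 1) * u + 2 * δ * ν) := fun h => h2ne (hU2φ ▸ (hker _).mpr h)
      have hU3 : ¬ p ∣ (p ^ (r + 1) * u - 3 * δ * ν) := fun h => h3ne (hU3φ ▸ (hker _).mpr h)
      rw [hZ2e, hZ3e, hzu, hnν, vpow u k hu, vpow _ _ hU2, vpow _ _ hU3, vpow ν a hν] at Ev
      rw [hZ2e, hZ3e, hzu, hnν, qpow u k hu, qpow _ _ hU2, qpow _ _ hU3, qpow ν a hν, hU2φ, hU3φ,
        qrBitZMod_mul (mul_ne_zero hφ2 hφδ) hφν, qrBitZMod_mul hφ2 hφδ,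
        qrBitZMod_mul (mul_ne_zero hφm3 hφδ) hφν, qrBitZMod_mul hφm3 hφδ] at Eq
      right; left
      refine ⟨?_, ?_, ?_, ?_⟩
      · show χv z + χv n = 0
        rw [hzu, hnν, vpow u k hu, vpow ν a hν]
        push_cast at Ev
        linear_combination (norm := (ring_nf; reduce_mod_char)) Ev
      · show χq z + χq n = _
        rw [hzu, hnν, qpow u k hu, qpow ν a hν]
        linear_combination (norm := (ring_nf; reduce_mod_char)) Eq
      · show χv (z + 2 * d * n) + χv n = 1
        rw [hZ2e, hnν, vpow _ _ hU2, vpow ν a hν]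
        push_cast
        linear_combination (norm := (ring_nf; reduce_mod_char))
      · show χq (z + 2 * d * n) + χq n = _
        rw [hZ2e, hnν, qpow _ _ hU2, qpow ν a hν, hU2φ, qrBitZMod_mul (mul_ne_zero hφ2 hφδ) hφν,
          qrBitZMod_mul hφ2 hφδ]
        linear_combination (norm := (ring_nf; reduce_mod_char))
    · -- `k = a + 1`
      have hk1 : k = a + 1 := le_antisymm hka2 hak
      have hZ2e : z + 2 * d * n = p ^ (a + 1) * (u + 2 * δ * ν) := by
        rw [hzu, hnν, hk1, hd]; ring
      have hZ3e : z - 3 * d * n = p ^ (a + 1) * (u - 3 * δ * ν) := by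
        rw [hzu, hnν, hk1, hd]; ring
      have hU2ne : u + 2 * δ * ν ≠ 0 := by
        intro h; rw [h, mul_zero] at hZ2e; exact hZ2 hZ2e
      have hU3ne : u - 3 * δ * ν ≠ 0 := by
        intro h; rw [h, mul_zero] at hZ3e; exact hZ3 hZ3e
      have hφU2 : φ (u + 2 * δ * ν) = φ u + 2 * φ δ * φ ν := by simp [map_add, map_mul, map_ofNat]
      have hφU3 : φ (u - 3 * δ * ν) = φ u - 3 * φ δ * φ ν := by simp [map_sub, map_mul, map_ofNat]
      by_cases hs2 : φ u + 2 * φ δ * φ ν = 0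
      · -- `x/p ≡ -2δ`
        have hpU2 : p ∣ u + 2 * δ * ν := (hker _).mp (hφU2.trans hs2)
        obtain ⟨U2, hU2e, hU2⟩ := exists_eq_pow_multiplicity_mul hp hU2ne
        set k2 := multiplicity p (u + 2 * δ * ν) with hk2
        have hφu' : φ u = -2 * φ δ * φ ν := by linear_combination hs2
        have hφU3' : φ (u - 3 * δ * ν) = -5 * φ δ * φ ν := by rw [hφU3, hφu']; ring
        have h5ne : (-5 : ZMod q) * φ δ * φ ν ≠ 0 := mul_ne_zero (mul_ne_zero hφm5 hφδ) hφν
        have hU3 : ¬ p ∣ u - 3 * δ * ν := fun h => h5ne (hφU3' ▸ (hker _).mpr h)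
        have hZ2f : z + 2 * d * n = p ^ (a + 1 + k2) * U2 := by rw [hZ2e, hU2e]; ring
        rw [hZ2f, hZ3e, hzu, hnν, hk1, vpow u _ hu, vpow _ _ hU2, vpow _ _ hU3, vpow ν a hν] at Ev
        rw [hZ2f, hZ3e, hzu, hnν, hk1, qpow u _ hu, qpow _ _ hU2, qpow _ _ hU3, qpow ν a hν, hφu',
          hφU3', qrBitZMod_mul (mul_ne_zero hφm2 hφδ) hφν, qrBitZMod_mul hφm2 hφδ,
          qrBitZMod_mul (mul_ne_zero hφm5 hφδ) hφν, qrBitZMod_mul hφm5 hφδ] at Eq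
        have hk2one : ((k2 : ℕ) : ZMod 2) = 1 := by
          push_cast at Ev
          linear_combination (norm := (ring_nf; reduce_mod_char)) -Ev
        right; right; left
        refine ⟨?_, ?_, ?_, ?_⟩
        · show χv z + χv n = 1
          rw [hzu, hnν, hk1, vpow u _ hu, vpow ν a hν]; push_cast
          linear_combination (norm := (ring_nf; reduce_mod_char))
        · show χq z + χq n = _
          rw [hzu, hnν, hk1, qpow u _ hu, qpow ν a hν, hφu',
            qrBitZMod_mul (mul_ne_zero hφm2 hφδ) hφν, qrBitZMod_mul hφm2 hφδ]
          linear_combination (norm := (ring_nf; reduce_mod_char))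
        · show χv (z + 2 * d * n) + χv n = 0
          rw [hZ2f, hnν, vpow _ _ hU2, vpow ν a hν]; push_cast; rw [hk2one]
          linear_combination (norm := (ring_nf; reduce_mod_char))
        · show χq (z + 2 * d * n) + χq n = _
          rw [hZ2f, hnν, qpow _ _ hU2, qpow ν a hν]
          linear_combination (norm := (ring_nf; reduce_mod_char)) Eq
      · by_cases hs3 : φ u - 3 * φ δ * φ ν = 0
        · -- `x/p ≡ 3δ`
          have hpU3 : p ∣ u - 3 * δ * ν := (hker _).mp (hφU3.trans hs3)
          obtain ⟨U3, hU3e, hU3⟩ := exists_eq_pow_multiplicity_mul hp hU3ne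
          set k3 := multiplicity p (u - 3 * δ * ν) with hk3
          have hφu' : φ u = 3 * φ δ * φ ν := by linear_combination hs3
          have hφU2' : φ (u + 2 * δ * ν) = 5 * φ δ * φ ν := by rw [hφU2, hφu']; ring
          have h5ne : (5 : ZMod q) * φ δ * φ ν ≠ 0 := mul_ne_zero (mul_ne_zero hφ5 hφδ) hφν
          have hU2 : ¬ p ∣ u + 2 * δ * ν := fun h => h5ne (hφU2' ▸ (hker _).mpr h)
          have hZ3f : z - 3 * d * n = p ^ (a + 1 + k3) * U3 := by rw [hZ3e, hU3e]; ring
          rw [hZ2e, hZ3f, hzu, hnν, hk1, vpow u _ hu, vpow _ _ hU2, vpow _ _ hU3, vpow ν a hν]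
            at Ev
          right; right; right
          refine ⟨?_, ?_, ?_, ?_⟩
          · show χv z + χv n = 1
            rw [hzu, hnν, hk1, vpow u _ hu, vpow ν a hν]; push_cast
            linear_combination (norm := (ring_nf; reduce_mod_char))
          · show χq z + χq n = _
            rw [hzu, hnν, hk1, qpow u _ hu, qpow ν a hν, hφu',
              qrBitZMod_mul (mul_ne_zero hφ3 hφδ) hφν, qrBitZMod_mul hφ3 hφδ]
            linear_combination (norm := (ring_nf; reduce_mod_char))
          · show χv (z + 2 * d * n) + χv n = 1
            rw [hZ2e, hnν, vpow _ _ hU2, vpow ν a hν]; push_cast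
            linear_combination (norm := (ring_nf; reduce_mod_char))
          · show χq (z + 2 * d * n) + χq n = _
            rw [hZ2e, hnν, qpow _ _ hU2, qpow ν a hν, hφU2',
              qrBitZMod_mul (mul_ne_zero hφ5 hφδ) hφν, qrBitZMod_mul hφ5 hφδ]
            linear_combination (norm := (ring_nf; reduce_mod_char))
        · -- both units: the valuation of `y²` would be odd
          exfalso
          have hU2 : ¬ p ∣ u + 2 * δ * ν := fun h => hs2 (hφU2 ▸ (hker _).mpr h)
          have hU3 : ¬ p ∣ u - 3 * δ * ν := fun h => hs3 (hφU3 ▸ (hker _).mpr h)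
          rw [hZ2e, hZ3e, hzu, hnν, hk1, vpow u _ hu, vpow _ _ hU2, vpow _ _ hU3, vpow ν a hν]
            at Ev
          push_cast at Ev
          have h01 : (0 : ZMod 2) = 1 := by
            linear_combination (norm := (ring_nf; reduce_mod_char)) Ev
          exact absurd h01 (by decide)
  · -- `k ≤ a`
    obtain ⟨r, hr⟩ := Nat.exists_eq_add_of_le hka
    have hZ2e : z + 2 * d * n = p ^ k * (u + 2 * δ * p ^ (r + 1) * ν) := by
      rw [hzu, hnν, hr, hd]; ring
    have hZ3e : z - 3 * d * n = p ^ k * (u - 3 * δ * p ^ (r + 1) * ν) := by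
      rw [hzu, hnν, hr, hd]; ring
    have hU2φ : φ (u + 2 * δ * p ^ (r + 1) * ν) = φ u := by
      simp [map_add, map_mul, map_pow, hφp]
    have hU3φ : φ (u - 3 * δ * p ^ (r + 1) * ν) = φ u := by
      simp [map_sub, map_mul, map_pow, hφp]
    have hU2 : ¬ p ∣ (u + 2 * δ * p ^ (r + 1) * ν) := fun h => hφu (hU2φ ▸ (hker _).mpr h)
    have hU3 : ¬ p ∣ (u - 3 * δ * p ^ (r + 1) * ν) := fun h => hφu (hU3φ ▸ (hker _).mpr h)
    rw [hZ2e, hZ3e, hzu, hnν, vpow u k hu, vpow _ k hU2, vpow _ k hU3, vpow ν a hν] at Ev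
    rw [hZ2e, hZ3e, hzu, hnν, qpow u k hu, qpow _ k hU2, qpow _ k hU3, qpow ν a hν, hU2φ, hU3φ]
      at Eq
    left
    refine ⟨?_, ?_, ?_, ?_⟩
    · show χv z + χv n = 0
      rw [hzu, hnν, vpow u k hu, vpow ν a hν]
      linear_combination (norm := (ring_nf; reduce_mod_char)) Ev
    · show χq z + χq n = 0
      rw [hzu, hnν, qpow u k hu, qpow ν a hν]
      linear_combination (norm := (ring_nf; reduce_mod_char)) Eq
    · show χv (z + 2 * d * n) + χv n = 0
      rw [hZ2e, hnν, vpow _ k hU2, vpow ν a hν]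
      linear_combination (norm := (ring_nf; reduce_mod_char)) Ev
    · show χq (z + 2 * d * n) + χq n = 0
      rw [hZ2e, hnν, qpow _ k hU2, qpow ν a hν, hU2φ]
      linear_combination (norm := (ring_nf; reduce_mod_char)) Eq

end Additive

/-! ### The instances used by the four descents -/

/-- Non-divisibility from a non-zero reduction. [folklore] -/
theorem not_dvd_of_apply_ne_zero {A : Type*} [CommRing A] {φ : ℤ[i] →+* A} {p : ℤ[i]}
    (hker : ∀ z, φ z = 0 ↔ p ∣ z) {c : ℤ[i]} (h : φ c ≠ 0) : ¬ p ∣ c :=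
  fun hd => h ((hker c).mpr hd)

/-- **Local conditions at `2 + i`** (`d ∈ {1, 41, 73, 2993}`, `2 + i ∤ d`):
`ord(b₁) ≡ 0` and `qr(b₁) = ord(b₂) · (1 + qr(d))`. [cite: SilvermanAEC2009, Ch. X §1 (Prop. X.1.4)] -/
theorem five_a_conditions {d : ℤ} (hd : ¬ g5a ∣ d) {z n w m : ℤ[i]} (hn : n ≠ 0) (hm : m ≠ 0)
    (hw : w ≠ 0) (heq : w ^ 2 * n ^ 3 = m ^ 2 * (z * (z + 2 * d * n) * (z - 3 * d * n))) :
    MulBit.ofPrime g5a prime_g5a z + MulBit.ofPrime g5a prime_g5a n = 0 ∧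
    MulBit.qr5a z + MulBit.qr5a n =
      (MulBit.ofPrime g5a prime_g5a (z + 2 * d * n) + MulBit.ofPrime g5a prime_g5a n) *
        (1 + qrBitZMod 5 (red5a d)) :=
  local_mult_five prime_g5a (p' := g5b) (by decide) (not_dvd_gen_of_ne (k := 2) (j := 3) (by decide))
    (not_dvd_of_apply_ne_zero red5a_eq_zero_iff (by decide))
    (not_dvd_of_apply_ne_zero red5a_eq_zero_iff (by decide)) red5a red5a_eq_zero_iff _ hd hn hm hw
    heq

/-- **Local conditions at `2 - i`** (`2 - i ∤ d`): `ord(b₁) ≡ 0` and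
`qr(b₁) = ord(b₂) · (1 + qr(d))`. [cite: SilvermanAEC2009, Ch. X §1 (Prop. X.1.4)] -/
theorem five_b_conditions {d : ℤ} (hd : ¬ g5b ∣ d) {z n w m : ℤ[i]} (hn : n ≠ 0) (hm : m ≠ 0)
    (hw : w ≠ 0) (heq : w ^ 2 * n ^ 3 = m ^ 2 * (z * (z + 2 * d * n) * (z - 3 * d * n))) :
    MulBit.ofPrime g5b prime_g5b z + MulBit.ofPrime g5b prime_g5b n = 0 ∧
    MulBit.qr5b z + MulBit.qr5b n =
      (MulBit.ofPrime g5b prime_g5b (z + 2 * d * n) + MulBit.ofPrime g5b prime_g5b n) *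
        (1 + qrBitZMod 5 (red5b d)) :=
  local_mult_five prime_g5b (p' := g5a) (by decide) (not_dvd_gen_of_ne (k := 3) (j := 2) (by decide))
    (not_dvd_of_apply_ne_zero red5b_eq_zero_iff (by decide))
    (not_dvd_of_apply_ne_zero red5b_eq_zero_iff (by decide)) red5b red5b_eq_zero_iff _ hd hn hm hw
    heq

/-- Quadratic residues modulo `41`: `2, -2, -5, 5` are squares, `3, -3` are not. [folklore] -/
theorem qrBitZMod_fortyone : qrBitZMod 41 2 = 0 ∧ qrBitZMod 41 (-3) = 1 ∧ qrBitZMod 41 (-2) = 0 ∧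
    qrBitZMod 41 (-5) = 0 ∧ qrBitZMod 41 3 = 1 ∧ qrBitZMod 41 5 = 0 := by
  refine ⟨(qrBitZMod_eq_zero_iff _).mpr ⟨17, by decide⟩,
    (qrBitZMod_eq_one_iff _).mpr (not_isSquare_of_forall_ne _ (by decide)),
    (qrBitZMod_eq_zero_iff _).mpr ⟨11, by decide⟩, (qrBitZMod_eq_zero_iff _).mpr ⟨6, by decide⟩,
    (qrBitZMod_eq_one_iff _).mpr (not_isSquare_of_forall_ne _ (by decide)),
    (qrBitZMod_eq_zero_iff _).mpr ⟨13, by decide⟩⟩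

/-- Quadratic residues modulo `73`: `2, -3, -2, 3` are squares, `-5, 5` are not. [folklore] -/
theorem qrBitZMod_seventythree : qrBitZMod 73 2 = 0 ∧ qrBitZMod 73 (-3) = 0 ∧
    qrBitZMod 73 (-2) = 0 ∧ qrBitZMod 73 (-5) = 1 ∧ qrBitZMod 73 3 = 0 ∧ qrBitZMod 73 5 = 1 := by
  refine ⟨(qrBitZMod_eq_zero_iff _).mpr ⟨32, by decide⟩, (qrBitZMod_eq_zero_iff _).mpr ⟨56, by decide⟩,
    (qrBitZMod_eq_zero_iff _).mpr ⟨61, by decide⟩,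
    (qrBitZMod_eq_one_iff _).mpr (not_isSquare_of_forall_ne _ (by decide)),
    (qrBitZMod_eq_zero_iff _).mpr ⟨21, by decide⟩,
    (qrBitZMod_eq_one_iff _).mpr (not_isSquare_of_forall_ne _ (by decide))⟩

/-- **Local conditions at `5 + 4i`** (`41 ∣ d`, `d = (5+4i) δ`, `qr(δ) = 0`):
`qr(b₁) = ord(b₂)` and `qr(b₂) = 0`. [cite: SilvermanAEC2009, Ch. X §1 (Prop. X.1.4)] -/
theorem fortyone_a_conditions {d : ℤ} {δ : ℤ[i]} (hd : (d : ℤ[i]) = g41a * δ) (hδ : ¬ g41a ∣ δ)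
    (hCδ : qrBitZMod 41 (red41a δ) = 0) {z n w m : ℤ[i]} (hn : n ≠ 0) (hm : m ≠ 0) (hw : w ≠ 0)
    (heq : w ^ 2 * n ^ 3 = m ^ 2 * (z * (z + 2 * d * n) * (z - 3 * d * n))) :
    MulBit.qr41a z + MulBit.qr41a n =
      MulBit.ofPrime g41a prime_g41a (z + 2 * d * n) + MulBit.ofPrime g41a prime_g41a n ∧
    MulBit.qr41a (z + 2 * d * n) + MulBit.qr41a n = 0 := by
  obtain ⟨C2, Cm3, Cm2, Cm5, C3, C5⟩ := qrBitZMod_fortyone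
  have h := local_additive prime_g41a hδ (not_dvd_of_apply_ne_zero red41a_eq_zero_iff (by decide))
    (not_dvd_of_apply_ne_zero red41a_eq_zero_iff (by decide))
    (not_dvd_of_apply_ne_zero red41a_eq_zero_iff (by decide)) red41a red41a_eq_zero_iff
    (qrBitZMod_redHom_mul _ red41a_eq_zero_iff) hd hn hm hw heq
  simp only [C2, Cm3, Cm2, Cm5, C3, C5, hCδ] at h
  show MulBit.qr41a z + MulBit.qr41a n = _ ∧ MulBit.qr41a (z + 2 * d * n) + MulBit.qr41a n = 0
  unfold MulBit.qr41a
  rcases h with ⟨h1, h2, h3, h4⟩ | ⟨h1, h2, h3, h4⟩ | ⟨h1, h2, h3, h4⟩ | ⟨h1, h2, h3, h4⟩ <;>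
    rw [h2, h3, h4] <;> decide

/-- **Local conditions at `5 - 4i`** (`41 ∣ d`, `d = (5-4i) δ`, `qr(δ) = 0`):
`qr(b₁) = ord(b₂)` and `qr(b₂) = 0`. [cite: SilvermanAEC2009, Ch. X §1 (Prop. X.1.4)] -/
theorem fortyone_b_conditions {d : ℤ} {δ : ℤ[i]} (hd : (d : ℤ[i]) = g41b * δ) (hδ : ¬ g41b ∣ δ)
    (hCδ : qrBitZMod 41 (red41b δ) = 0) {z n w m : ℤ[i]} (hn : n ≠ 0) (hm : m ≠ 0) (hw : w ≠ 0)
    (heq : w ^ 2 * n ^ 3 = m ^ 2 * (z * (z + 2 * d * n) * (z - 3 * d * n))) :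
    MulBit.qr41b z + MulBit.qr41b n =
      MulBit.ofPrime g41b prime_g41b (z + 2 * d * n) + MulBit.ofPrime g41b prime_g41b n ∧
    MulBit.qr41b (z + 2 * d * n) + MulBit.qr41b n = 0 := by
  obtain ⟨C2, Cm3, Cm2, Cm5, C3, C5⟩ := qrBitZMod_fortyone
  have h := local_additive prime_g41b hδ (not_dvd_of_apply_ne_zero red41b_eq_zero_iff (by decide))
    (not_dvd_of_apply_ne_zero red41b_eq_zero_iff (by decide))
    (not_dvd_of_apply_ne_zero red41b_eq_zero_iff (by decide)) red41b red41b_eq_zero_iff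
    (qrBitZMod_redHom_mul _ red41b_eq_zero_iff) hd hn hm hw heq
  simp only [C2, Cm3, Cm2, Cm5, C3, C5, hCδ] at h
  show MulBit.qr41b z + MulBit.qr41b n = _ ∧ MulBit.qr41b (z + 2 * d * n) + MulBit.qr41b n = 0
  unfold MulBit.qr41b
  rcases h with ⟨h1, h2, h3, h4⟩ | ⟨h1, h2, h3, h4⟩ | ⟨h1, h2, h3, h4⟩ | ⟨h1, h2, h3, h4⟩ <;>
    rw [h2, h3, h4] <;> decide

/-- **Local conditions at `8 + 3i`** (`73 ∣ d`, `d = (8+3i) δ`, `qr(δ) = 0`):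
`qr(b₁) = 0` and `qr(b₂) = ord(b₁)`. [cite: SilvermanAEC2009, Ch. X §1 (Prop. X.1.4)] -/
theorem seventythree_a_conditions {d : ℤ} {δ : ℤ[i]} (hd : (d : ℤ[i]) = g73a * δ)
    (hδ : ¬ g73a ∣ δ) (hCδ : qrBitZMod 73 (red73a δ) = 0) {z n w m : ℤ[i]} (hn : n ≠ 0)
    (hm : m ≠ 0) (hw : w ≠ 0)
    (heq : w ^ 2 * n ^ 3 = m ^ 2 * (z * (z + 2 * d * n) * (z - 3 * d * n))) :
    MulBit.qr73a z + MulBit.qr73a n = 0 ∧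
    MulBit.qr73a (z + 2 * d * n) + MulBit.qr73a n =
      MulBit.ofPrime g73a prime_g73a z + MulBit.ofPrime g73a prime_g73a n := by
  obtain ⟨C2, Cm3, Cm2, Cm5, C3, C5⟩ := qrBitZMod_seventythree
  have h := local_additive prime_g73a hδ (not_dvd_of_apply_ne_zero red73a_eq_zero_iff (by decide))
    (not_dvd_of_apply_ne_zero red73a_eq_zero_iff (by decide))
    (not_dvd_of_apply_ne_zero red73a_eq_zero_iff (by decide)) red73a red73a_eq_zero_iff
    (qrBitZMod_redHom_mul _ red73a_eq_zero_iff) hd hn hm hw heq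
  simp only [C2, Cm3, Cm2, Cm5, C3, C5, hCδ] at h
  show MulBit.qr73a z + MulBit.qr73a n = 0 ∧ MulBit.qr73a (z + 2 * d * n) + MulBit.qr73a n = _
  unfold MulBit.qr73a
  rcases h with ⟨h1, h2, h3, h4⟩ | ⟨h1, h2, h3, h4⟩ | ⟨h1, h2, h3, h4⟩ | ⟨h1, h2, h3, h4⟩ <;>
    rw [h1, h2, h4] <;> decide

/-- **Local conditions at `8 - 3i`** (`73 ∣ d`, `d = (8-3i) δ`, `qr(δ) = 0`):
`qr(b₁) = 0` and `qr(b₂) = ord(b₁)`. [cite: SilvermanAEC2009, Ch. X §1 (Prop. X.1.4)] -/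
theorem seventythree_b_conditions {d : ℤ} {δ : ℤ[i]} (hd : (d : ℤ[i]) = g73b * δ)
    (hδ : ¬ g73b ∣ δ) (hCδ : qrBitZMod 73 (red73b δ) = 0) {z n w m : ℤ[i]} (hn : n ≠ 0)
    (hm : m ≠ 0) (hw : w ≠ 0)
    (heq : w ^ 2 * n ^ 3 = m ^ 2 * (z * (z + 2 * d * n) * (z - 3 * d * n))) :
    MulBit.qr73b z + MulBit.qr73b n = 0 ∧
    MulBit.qr73b (z + 2 * d * n) + MulBit.qr73b n =
      MulBit.ofPrime g73b prime_g73b z + MulBit.ofPrime g73b prime_g73b n := by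
  obtain ⟨C2, Cm3, Cm2, Cm5, C3, C5⟩ := qrBitZMod_seventythree
  have h := local_additive prime_g73b hδ (not_dvd_of_apply_ne_zero red73b_eq_zero_iff (by decide))
    (not_dvd_of_apply_ne_zero red73b_eq_zero_iff (by decide))
    (not_dvd_of_apply_ne_zero red73b_eq_zero_iff (by decide)) red73b red73b_eq_zero_iff
    (qrBitZMod_redHom_mul _ red73b_eq_zero_iff) hd hn hm hw heq
  simp only [C2, Cm3, Cm2, Cm5, C3, C5, hCδ] at h
  show MulBit.qr73b z + MulBit.qr73b n = 0 ∧ MulBit.qr73b (z + 2 * d * n) + MulBit.qr73b n = _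
  unfold MulBit.qr73b
  rcases h with ⟨h1, h2, h3, h4⟩ | ⟨h1, h2, h3, h4⟩ | ⟨h1, h2, h3, h4⟩ | ⟨h1, h2, h3, h4⟩ <;>
    rw [h1, h2, h4] <;> decide

end Literature.Barriers.BirchSwinnertonDyer.DokchitserDokchitser2011
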